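import Mathlib
import Summits.ResolutionOfSingularities.ResolutionOfSingularities.Theorems.RadicialJungCleanModelsCleanLUDimCases
import Summits.ResolutionOfSingularities.ResolutionOfSingularities.Theorems.RadicialJungCleanModelsCleanLUDimDefectless
import HarnessLib

/-!
# Route `RadicialJung`, crux `CleanModels` (stmt-15917), line `Sketch` rev 35, stub 7 `stub_cleanModelsDimGEFour`: the frontier stub
# VERBATIM from embedded resolution in dimension `≥ 3`, the dim-`d` non-discrete defect residue and dim-`d` two-model patching

Explicit-unit seat `decomp-res-hand-2` g2 (structural hand, stubs 5–7).  OURS; nothing here proves resolution in characteristic `p`.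

hand-2 g0's ✓ `cleanModelsDimGEFour_of_localCases_of_cleanTwoModelPatching` (`…CleanLUDimCases.lean`) reduces the frontier stub BY NAME to
FOUR inputs asked in every dimension `d ≥ 4` — `hBest_d` (defectless clean LU_d), `hAbh_d` (Abhyankar clean LU_d), `hND_d` (the non-discrete
defect residue, class (B)_d) and `hZ_d` (two-model patching for `P_clean` in transcendence degree `d`) — the arc class and all the glue being
proved.  With ✓ `cleanLU_dim_of_isMin_pthPowerApprox` / ✓ `cleanLU_dim_of_transcendenceDefect_eq_zero` (`…CleanLUDimDefectless.lean`, this seat)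
the first two are DISCHARGED in every dimension modulo ONE classical hypothesis, so the frontier stub now reads

  `stub_cleanModelsDimGEFour` ⟸ `hEmb_{≥3}` ∧ `hND_{≥4}` ∧ `hZ_{≥4}`,

where `hEmb_N` = embedded resolution of closed proper subsets of dimension `≤ N` of regular excellent integral Noetherian schemes in the shape
of Cossart–Jannsen–Saito 2020 Cor. 1.5 (used at `N = d − 1 ≥ 3`: the remainder hypersurface `g₀ − f₀^p = 0` of the `d`-dimensional regular
centre).  Census of the three remaining inputs (all OPEN for `d ≥ 4`, none dressed as a fact): `hEmb_N`, `N ≥ 3` — embedded resolution in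
positive characteristic beyond surfaces (CJS 2020 is `N = 2`; Cossart–Piltant 2019 is NON-embedded resolution of threefolds); `hND_d` — the
dim-`d` form of the line's research residue (class (B): rank-one non-discrete defect valuations); `hZ_d` — Piltant 2013 Prop. 5.1 in
dimension `≥ 4` (Zariski's bad-curve induction is three-dimensional; Piltant 2013, p. 2).

* `cleanModelsDimGEFour_of_embeddedResolution` — the frontier stub VERBATIM from `hEmb_N` (`N ≥ 3`), `hND_d`, `hZ_d` (`d ≥ 4`);
* `cleanModelsDimGEFour_of_embeddedResolution'` — the same with the dimension-unrestricted embedded-resolution hypothesis (Hironaka shape).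

Structural bookkeeping, counted 0.
-/

noncomputable section

set_option linter.dupNamespace false -- mandated namespace of this single-conjunct summit

open CategoryTheory AlgebraicGeometry IsLocalRing
open Literature.AlgebraicGeometry.Resolution Literature.AlgebraicGeometry.Motives

namespace Summit.ResolutionOfSingularities.ResolutionOfSingularities.Theorems.RadicialJung.CleanModels

/-- **The frontier stub `stub_cleanModelsDimGEFour` (statement VERBATIM) from embedded resolution of closed subsets of every dimension
`N ≥ 3` of regular excellent schemes (`hEmb`, CJS Cor. 1.5 shape; OPEN for `N ≥ 3`), the dim-`d` non-discrete defect residue `hND` and dim-`d`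
two-model patching for `P_clean` `hZ` (`d ≥ 4`, both OPEN).**  Composition of hand-2 g0's ✓ `cleanModelsDimGEFour_of_localCases_of_cleanTwoModelPatching`
with ✓ `cleanLU_dim_of_isMin_pthPowerApprox` and ✓ `cleanLU_dim_of_transcendenceDefect_eq_zero` at `N = n = d − 1`.  Structural reduction only.
[cite: CossartJannsenSaito2020, Cor. 1.5, p. 7] [cite: Piltant2013, Cor. 5.7 and p. 2] [cite: Kuhlmann2010, Thm. 1.1] -/
theorem cleanModelsDimGEFour_of_embeddedResolution
    (hEmb : ∀ N : ℕ, 3 ≤ N → ∀ (Z : Scheme.{0}) [IsIntegral Z] [IsNoetherian Z], Scheme.IsRegular Z →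
      Scheme.IsExcellent Z → ∀ (X : Set Z), IsClosed X → X ≠ Set.univ → topologicalKrullDim X ≤ N →
        ∃ (Z' : Scheme.{0}) (π : Z' ⟶ Z), IsProper π ∧ Function.Surjective π.base ∧
          (∃ U : Z.Opens, (U : Set Z) = Xᶜ ∧ IsIso (π ∣_ U)) ∧
          IsStrictNormalCrossingsDivisor Z' (π.base ⁻¹' X))
    (hND : ∀ d : ℕ, 4 ≤ d → ∀ (p : ℕ), p.Prime →
    ∀ (k : Type) [Field k] [CharP k p] (K : Type) [Field K] [Algebra k K]
    (O : ValuationSubring K) (A : Subalgebra k K), A.toSubring ≤ O.toSubring → A.FG → IsFractionRing A K →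
    ringKrullDim A ≤ (d : WithBot ℕ∞) → IsRegularLocalRing (locAtCentre A.toSubring O) →
    ringKrullDim (locAtCentre A.toSubring O) = (d : WithBot ℕ∞) →
    (∀ (T : Subring K) (hT : T ≤ O.toSubring), A.toSubring ≤ T → (subringCentre T O hT).IsMaximal) →
    ∀ g₀ : K, (∀ c : K, c ^ p ≠ g₀) →
    (∀ f₀ : K, ∃ f₁ : K, O.valuation (g₀ - f₁ ^ p) < O.valuation (g₀ - f₀ ^ p)) →
    (∀ hk : ∀ c : k, algebraMap k K c ∈ O, transcendenceDefect k O hk ≠ 0) →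
    ¬ (∃ π : K, π ≠ 0 ∧ (∀ x : K, O.valuation x < 1 → O.valuation x ≤ O.valuation π) ∧
      (∀ x : K, x ≠ 0 → ∃ n : ℕ, O.valuation π ^ n ≤ O.valuation x)) →
    ∃ (A' : Subalgebra k K), A'.toSubring ≤ O.toSubring ∧ A ≤ A' ∧ A'.FG ∧
    ∃ (_ : IsRegularLocalRing (locAtCentre A'.toSubring O)) (c : Fin p → K), (∃ j : Fin p, (j : ℕ) ≠ 0 ∧ c j ≠ 0) ∧
    ((∃ (d m : ℕ) (hmd : m ≤ d) (t : Fin d → ↥(locAtCentre A'.toSubring O)) (a : Fin m → ℕ) (u : ↥(locAtCentre A'.toSubring O)), IsUnit u ∧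
    Ideal.span (Set.range t) = IsLocalRing.maximalIdeal ↥(locAtCentre A'.toSubring O) ∧
    ringKrullDim ↥(locAtCentre A'.toSubring O) = (d : WithBot ℕ∞) ∧ 0 < m ∧ (∀ i, ¬ p ∣ a i) ∧
    (∑ j : Fin p, c j ^ p * g₀ ^ (j : ℕ)) = (u : K) * ∏ i : Fin m, ((t (Fin.castLE hmd i) : ↥(locAtCentre A'.toSubring O)) : K) ^ (a i)) ∨
    (∃ u : ↥(locAtCentre A'.toSubring O), IsUnit u ∧ (∑ j : Fin p, c j ^ p * g₀ ^ (j : ℕ)) = (u : K) ∧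
    ∀ c' : ↥(locAtCentre A'.toSubring O), u - c' ^ p ∉ IsLocalRing.maximalIdeal ↥(locAtCentre A'.toSubring O)) ∨
    (∃ s c' : ↥(locAtCentre A'.toSubring O), (∑ j : Fin p, c j ^ p * g₀ ^ (j : ℕ)) = (s : K) ∧
    s - c' ^ p ∈ IsLocalRing.maximalIdeal ↥(locAtCentre A'.toSubring O) ∧
    s - c' ^ p ∉ IsLocalRing.maximalIdeal ↥(locAtCentre A'.toSubring O) ^ 2)))
    (hZ : ∀ d : ℕ, 4 ≤ d → ∀ (p : ℕ), p.Prime → ∀ (k K : Type) [Field k] [CharP k p] [Field K] [Algebra k K]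
    [Algebra.EssFiniteType k K],
    Algebra.trdeg k K = d → ∀ (g₀ : K) (M₁ M₂ : ProjModel k K) (U₁ : M₁.X.Opens) (U₂ : M₂.X.Opens),
    (∀ x ∈ U₁, ModelCleanRegAt p g₀ M₁ x) → (∀ x ∈ U₂, ModelCleanRegAt p g₀ M₂ x) →
    ∃ (N : ProjModel k K) (φ₁ : N.Hom M₁) (φ₂ : N.Hom M₂),
    (∀ y : N.X, φ₁.f y ∈ U₁ → ModelCleanRegAt p g₀ N y) ∧ (∀ y : N.X, φ₂.f y ∈ U₂ → ModelCleanRegAt p g₀ N y)) :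
    ∀ p : ℕ, p.Prime → ∀ (k : Type) [Field k] [CharP k p] (W : AlgebraicGeometry.Scheme.{0}) [AlgebraicGeometry.IsIntegral W] (f : W ⟶ AlgebraicGeometry.Spec (.of k)) (L : Type) [Field L] [Algebra W.functionField L], AlgebraicGeometry.IsSeparated f → AlgebraicGeometry.LocallyOfFiniteType f → AlgebraicGeometry.QuasiCompact f → Literature.AlgebraicGeometry.Resolution.Scheme.IsRegular W → IsPurelyInseparable W.functionField L → Module.finrank W.functionField L = p → ¬ topologicalKrullDim W ≤ 3 → ∃ (V : AlgebraicGeometry.Scheme.{0}) (π : V ⟶ W) (_ : AlgebraicGeometry.IsIntegral V) (_ : AlgebraicGeometry.IsDominant π), AlgebraicGeometry.IsProper π ∧ Literature.AlgebraicGeometry.Resolution.IsBirational π ∧ Literature.AlgebraicGeometry.Resolution.Scheme.IsRegular V ∧ (∀ v : V, (∃ (y : L) (g : W.functionField), y ∉ Set.range (algebraMap W.functionField L) ∧ algebraMap W.functionField L g = y ^ p ∧ ((∃ (d m : ℕ) (hmd : m ≤ d) (t : Fin d → V.presheaf.stalk v) (a : Fin m → ℕ), Ideal.span (Set.range t) =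 IsLocalRing.maximalIdeal (V.presheaf.stalk v) ∧ ringKrullDim (V.presheaf.stalk v) = (d : WithBot ℕ∞) ∧ 0 < m ∧ (∀ i, ¬ p ∣ a i) ∧ Literature.AlgebraicGeometry.Motives.RatFn.functionFieldMap π g = ∏ i : Fin m, (algebraMap (V.presheaf.stalk v) V.functionField (t (Fin.castLE hmd i))) ^ (a i)) ∨ (∃ u₀ : V.presheaf.stalk v, IsUnit u₀ ∧ Literature.AlgebraicGeometry.Motives.RatFn.functionFieldMap π g = algebraMap (V.presheaf.stalk v) V.functionField u₀ ∧ ((∀ c : V.presheaf.stalk v, u₀ - c ^ p ∉ IsLocalRing.maximalIdeal (V.presheaf.stalk v)) ∨ (∃ c : V.presheaf.stalk v, u₀ - c ^ p ∈ IsLocalRing.maximalIdeal (V.presheaf.stalk v) ∧ u₀ - c ^ p ∉ IsLocalRing.maximalIdeal (V.presheaf.stalk v) ^ 2)))))) := by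
  refine cleanModelsDimGEFour_of_localCases_of_cleanTwoModelPatching ?_ ?_ hND hZ
  · intro d hd p hp k _ _ K _ _ O A hAO hAfg hfrac _hdimA hreg hdim _hzd g₀ hg₀ f₀ hf₀
    have hdim' : ringKrullDim ↥(locAtCentre A.toSubring O) = ((d - 1 + 1 : ℕ) : WithBot ℕ∞) := by
      rw [hdim, Nat.sub_add_cancel (by omega)]
    exact cleanLU_dim_of_isMin_pthPowerApprox (d - 1) (hEmb (d - 1) (by omega)) p hp k K O A hAO hAfg hfrac hreg
      (n := d - 1) le_rfl hdim' g₀ hg₀ f₀ hf₀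
  · intro d hd p hp k _ _ K _ _ O A hAO hAfg hfrac _hdimA hreg hdim _hzd g₀ hg₀ hk htd
    have hdim' : ringKrullDim ↥(locAtCentre A.toSubring O) = ((d - 1 + 1 : ℕ) : WithBot ℕ∞) := by
      rw [hdim, Nat.sub_add_cancel (by omega)]
    exact cleanLU_dim_of_transcendenceDefect_eq_zero (d - 1) (hEmb (d - 1) (by omega)) p hp k K O A hAO hAfg hfrac hreg
      (n := d - 1) le_rfl hdim' g₀ hg₀ hk htd

/-- **The frontier stub `stub_cleanModelsDimGEFour` (statement VERBATIM) from embedded resolution of ALL closed proper subsets of regular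
excellent schemes (no dimension bound — the Hironaka-shape hypothesis, OPEN in positive characteristic), `hND_d` and `hZ_d` (`d ≥ 4`).**
Corollary of `cleanModelsDimGEFour_of_embeddedResolution`. [cite: CossartJannsenSaito2020, Cor. 1.5, p. 7] [cite: Piltant2013, Cor. 5.7 and p. 2] -/
theorem cleanModelsDimGEFour_of_embeddedResolution'
    (hEmb : ∀ (Z : Scheme.{0}) [IsIntegral Z] [IsNoetherian Z], Scheme.IsRegular Z →
      Scheme.IsExcellent Z → ∀ (X : Set Z), IsClosed X → X ≠ Set.univ →
        ∃ (Z' : Scheme.{0}) (π : Z' ⟶ Z), IsProper π ∧ Function.Surjective π.base ∧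
          (∃ U : Z.Opens, (U : Set Z) = Xᶜ ∧ IsIso (π ∣_ U)) ∧
          IsStrictNormalCrossingsDivisor Z' (π.base ⁻¹' X))
    (hND : ∀ d : ℕ, 4 ≤ d → ∀ (p : ℕ), p.Prime →
    ∀ (k : Type) [Field k] [CharP k p] (K : Type) [Field K] [Algebra k K]
    (O : ValuationSubring K) (A : Subalgebra k K), A.toSubring ≤ O.toSubring → A.FG → IsFractionRing A K →
    ringKrullDim A ≤ (d : WithBot ℕ∞) → IsRegularLocalRing (locAtCentre A.toSubring O) →
    ringKrullDim (locAtCentre A.toSubring O) = (d : WithBot ℕ∞) →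
    (∀ (T : Subring K) (hT : T ≤ O.toSubring), A.toSubring ≤ T → (subringCentre T O hT).IsMaximal) →
    ∀ g₀ : K, (∀ c : K, c ^ p ≠ g₀) →
    (∀ f₀ : K, ∃ f₁ : K, O.valuation (g₀ - f₁ ^ p) < O.valuation (g₀ - f₀ ^ p)) →
    (∀ hk : ∀ c : k, algebraMap k K c ∈ O, transcendenceDefect k O hk ≠ 0) →
    ¬ (∃ π : K, π ≠ 0 ∧ (∀ x : K, O.valuation x < 1 → O.valuation x ≤ O.valuation π) ∧
      (∀ x : K, x ≠ 0 → ∃ n : ℕ, O.valuation π ^ n ≤ O.valuation x)) →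
    ∃ (A' : Subalgebra k K), A'.toSubring ≤ O.toSubring ∧ A ≤ A' ∧ A'.FG ∧
    ∃ (_ : IsRegularLocalRing (locAtCentre A'.toSubring O)) (c : Fin p → K), (∃ j : Fin p, (j : ℕ) ≠ 0 ∧ c j ≠ 0) ∧
    ((∃ (d m : ℕ) (hmd : m ≤ d) (t : Fin d → ↥(locAtCentre A'.toSubring O)) (a : Fin m → ℕ) (u : ↥(locAtCentre A'.toSubring O)), IsUnit u ∧
    Ideal.span (Set.range t) = IsLocalRing.maximalIdeal ↥(locAtCentre A'.toSubring O) ∧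
    ringKrullDim ↥(locAtCentre A'.toSubring O) = (d : WithBot ℕ∞) ∧ 0 < m ∧ (∀ i, ¬ p ∣ a i) ∧
    (∑ j : Fin p, c j ^ p * g₀ ^ (j : ℕ)) = (u : K) * ∏ i : Fin m, ((t (Fin.castLE hmd i) : ↥(locAtCentre A'.toSubring O)) : K) ^ (a i)) ∨
    (∃ u : ↥(locAtCentre A'.toSubring O), IsUnit u ∧ (∑ j : Fin p, c j ^ p * g₀ ^ (j : ℕ)) = (u : K) ∧
    ∀ c' : ↥(locAtCentre A'.toSubring O), u - c' ^ p ∉ IsLocalRing.maximalIdeal ↥(locAtCentre A'.toSubring O)) ∨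
    (∃ s c' : ↥(locAtCentre A'.toSubring O), (∑ j : Fin p, c j ^ p * g₀ ^ (j : ℕ)) = (s : K) ∧
    s - c' ^ p ∈ IsLocalRing.maximalIdeal ↥(locAtCentre A'.toSubring O) ∧
    s - c' ^ p ∉ IsLocalRing.maximalIdeal ↥(locAtCentre A'.toSubring O) ^ 2)))
    (hZ : ∀ d : ℕ, 4 ≤ d → ∀ (p : ℕ), p.Prime → ∀ (k K : Type) [Field k] [CharP k p] [Field K] [Algebra k K]
    [Algebra.EssFiniteType k K],
    Algebra.trdeg k K = d → ∀ (g₀ : K) (M₁ M₂ : ProjModel k K) (U₁ : M₁.X.Opens) (U₂ : M₂.X.Opens),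
    (∀ x ∈ U₁, ModelCleanRegAt p g₀ M₁ x) → (∀ x ∈ U₂, ModelCleanRegAt p g₀ M₂ x) →
    ∃ (N : ProjModel k K) (φ₁ : N.Hom M₁) (φ₂ : N.Hom M₂),
    (∀ y : N.X, φ₁.f y ∈ U₁ → ModelCleanRegAt p g₀ N y) ∧ (∀ y : N.X, φ₂.f y ∈ U₂ → ModelCleanRegAt p g₀ N y)) :
    ∀ p : ℕ, p.Prime → ∀ (k : Type) [Field k] [CharP k p] (W : AlgebraicGeometry.Scheme.{0}) [AlgebraicGeometry.IsIntegral W] (f : W ⟶ AlgebraicGeometry.Spec (.of k)) (L : Type) [Field L] [Algebra W.functionField L], AlgebraicGeometry.IsSeparated f → AlgebraicGeometry.LocallyOfFiniteType f → AlgebraicGeometry.QuasiCompact f → Literature.AlgebraicGeometry.Resolution.Scheme.IsRegular W → IsPurelyInseparable W.functionField L → Module.finrank W.functionField L = p → ¬ topologicalKrullDim W ≤ 3 → ∃ (V : AlgebraicGeometry.Scheme.{0}) (π : V ⟶ W) (_ : AlgebraicGeometry.IsIntegral V) (_ : AlgebraicGeometry.IsDominant π), AlgebraicGeometry.IsProper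 π ∧ Literature.AlgebraicGeometry.Resolution.IsBirational π ∧ Literature.AlgebraicGeometry.Resolution.Scheme.IsRegular V ∧ (∀ v : V, (∃ (y : L) (g : W.functionField), y ∉ Set.range (algebraMap W.functionField L) ∧ algebraMap W.functionField L g = y ^ p ∧ ((∃ (d m : ℕ) (hmd : m ≤ d) (t : Fin d → V.presheaf.stalk v) (a : Fin m → ℕ), Ideal.span (Set.range t) = IsLocalRing.maximalIdeal (V.presheaf.stalk v) ∧ ringKrullDim (V.presheaf.stalk v) = (d : WithBot ℕ∞) ∧ 0 < m ∧ (∀ i, ¬ p ∣ a i) ∧ Literature.AlgebraicGeometry.Motives.RatFn.functionFieldMap π g = ∏ i : Fin m, (algebraMap (V.presheaf.stalk v) V.functionField (t (Fin.castLE hmd i))) ^ (a i)) ∨ (∃ u₀ : V.presheaf.stalk v, IsUnit u₀ ∧ Literature.AlgebraicGeometry.Motives.RatFn.functionFieldMap π g = algebraMap (V.presheaf.stalk v) V.functionField u₀ ∧ ((∀ c : V.presheaf.stalk v, u₀ - c ^ p ∉ IsLocalRing.maximalIdeal (V.presheaf.stalk v)) ∨ (∃ c : V.presheaf.stalk v,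 u₀ - c ^ p ∈ IsLocalRing.maximalIdeal (V.presheaf.stalk v) ∧ u₀ - c ^ p ∉ IsLocalRing.maximalIdeal (V.presheaf.stalk v) ^ 2)))))) :=
  cleanModelsDimGEFour_of_embeddedResolution
    (fun _ _ Z _ _ hZr hZe X hXc hXu _ => hEmb Z hZr hZe X hXc hXu) hND hZ

end Summit.ResolutionOfSingularities.ResolutionOfSingularities.Theorems.RadicialJung.CleanModels

end
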